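import Summits.Parity.GeneralizedHardyLittlewood.Theorems.BeyondDiagonalBeatsQuarter.CornerWeight
import Summits.Parity.GeneralizedHardyLittlewood.Theorems.BeyondDiagonalBeatsQuarter.KernelFormXSqBridge
import Literature.NumberTheory.Sieve.SieveFrameworkProofs
import HarnessLib

/-!
# Route `PrimeLevelFamEdge`, crux K_B (stmt-Parity-20343), line `diagonal_kernel_split`, helper H1
# (`CornerNegligibleXSq`), part 5: the true diagonal kernel and the `τ`-decoupling of the corner

* `hKernel h Q a b = (ab)⁻¹ Σ_{c∣(a,b)} c·τ((a/c)(b/c))·h((a/c)(b/c)/Q²)` — a diagonal kernel with weight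
  `h`; `trueDiagKernel Q = hKernel 𝒲 Q` is the TRUE Petersson diagonal of the mollified second moment
  ([KowalskiMichelVanderKam2000] (21)–(23): Hecke recursion `c ∣ (a,b)`, divisor function of the reduced
  product, cut-off weight `𝒲((a/c)(b/c)/q̂²)`), while the tree's `KMV2000.kmvKernel (log Q)` keeps the
  `t = 0` residue `½ log(Q²/((a/c)(b/c)))`; `trueDiagKernel_sub_kmvKernel`: their difference is
  `hKernel E Q` with the corner weight `E = cornerE` of parts 1–2;
* `card_divisors_mul_eq_sum_moebius` — `τ(uv) = Σ_{d∣(u,v)} μ(d)τ(u/d)τ(v/d)` (Möbius inversion of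
  the tree's Hecke relation `τ(u)τ(v) = Σ_{c∣(u,v)} τ(uv/c²)`, `DivisorHeckeRelation`);
* `sum_sum_sum_gcd_divisors_eq` — the reindexing `(a,b,c∣(a,b)) ↔ (c,u,v)`, `a = cu`, `b = cv`;
* **`quadForm_hKernel_eq`** — for ANY coefficient vector `x`:
  `Σ_{a,b≤N} x_a x_b hKernel h Q a b = Σ_{c≤N} Σ_{d≤N/c} μ(d)c·Σ_{k₁,k₂≤N/(cd)} y(k₁)y(k₂)h(d²k₁k₂/Q²)`,
  `y(k) = τ(k)x_{cdk}/(cdk)` — the corner becomes a weighted family of decoupled double sums.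
Helper toward the heart stub (plan Ω, H1); closes nothing; standard axioms.
«The programme SEARCHES and TYPES; no claim about Landau–Siegel zeros, Theorems 1–2 of
arXiv:2211.02515 or a repaired Margin232 until a kernel theorem says so.»
-/

noncomputable section

open scoped Real ArithmeticFunction.Moebius ArithmeticFunction.zeta
open Finset ArithmeticFunction

namespace Summit.Parity.GeneralizedHardyLittlewood.Theorems.BeyondDiagonalBeatsQuarter.Corner

open Literature.NumberTheory.LFunctions Literature.NumberTheory.LFunctions.KMV2000
open Literature.NumberTheory.Multiplicative (cast_card_divisors_mul_card_divisors)
open Literature.Barriers.RiemannHypothesis.PropB (sum_divisors_gcd_eq_sum_Icc_ite)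
open KernelFormXSq (sum_Icc_ite_dvd_eq)

/-! ### The kernels -/

/-- A diagonal kernel with cut-off weight `h`:
`K_h(Q; a, b) = (ab)⁻¹ Σ_{c ∣ (a,b)} c·τ((a/c)(b/c))·h((a/c)(b/c)/Q²)`.
[cite: KowalskiMichelVanderKam2000, (21)–(23) pp. 12–13 — derivation (general cut-off weight)] -/
def hKernel (h : ℝ → ℝ) (Q : ℝ) (a b : ℕ) : ℝ :=
  (∑ c ∈ (Nat.gcd a b).divisors, (c : ℝ) * ((a / c * (b / c)).divisors.card : ℝ) *
      h (((a / c * (b / c) : ℕ) : ℝ) / Q ^ 2)) / ((a : ℝ) * b)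

/-- **The true diagonal kernel** of the mollified second moment at conductor scale `Q = q̂`:
`K_true(a,b) = (ab)⁻¹ Σ_{c ∣ (a,b)} c·τ((a/c)(b/c))·𝒲((a/c)(b/c)/Q²)`; replacing `𝒲(y)` by the
residue `½ log(1/y)` gives `KMV2000.kmvKernel (log Q) a b`.
[cite: KowalskiMichelVanderKam2000, (21)–(23) pp. 12–13 and Prop. 5.1 — derivation] -/
def trueDiagKernel (Q : ℝ) (a b : ℕ) : ℝ := hKernel scriptW Q a b

/-- **True minus continued diagonal is the `E`-kernel**: for `Q > 0`, `a, b ≥ 1`,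
`trueDiagKernel Q a b − kmvKernel (log Q) a b = hKernel cornerE Q a b`
(`½ log((a/c)(b/c)/Q²) = ½(log a + log b) − log c − log Q`).
[cite: KowalskiMichelVanderKam2000, (21)–(23) — derivation] -/
theorem trueDiagKernel_sub_kmvKernel {Q : ℝ} (hQ : 0 < Q) {a b : ℕ} (ha : a ≠ 0) (hb : b ≠ 0) :
    trueDiagKernel Q a b - kmvKernel (Real.log Q) a b = hKernel cornerE Q a b := by
  unfold trueDiagKernel hKernel kmvKernel
  rw [← sub_div, ← Finset.sum_sub_distrib]
  congr 1
  refine Finset.sum_congr rfl fun c hc ↦ ?_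
  obtain ⟨hcg, hg0⟩ := Nat.mem_divisors.1 hc
  have hca : c ∣ a := hcg.trans (Nat.gcd_dvd_left a b)
  have hcb : c ∣ b := hcg.trans (Nat.gcd_dvd_right a b)
  have hc0 : c ≠ 0 := by rintro rfl; exact hg0 (zero_dvd_iff.mp hcg)
  have hcR : (c : ℝ) ≠ 0 := by exact_mod_cast hc0
  have haR : (a : ℝ) ≠ 0 := by exact_mod_cast ha
  have hbR : (b : ℝ) ≠ 0 := by exact_mod_cast hb
  have hac : ((a / c : ℕ) : ℝ) = a / c := Nat.cast_div hca hcR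
  have hbc : ((b / c : ℕ) : ℝ) = b / c := Nat.cast_div hcb hcR
  have hlog : Real.log (((a / c * (b / c) : ℕ) : ℝ) / Q ^ 2) =
      Real.log a + Real.log b - 2 * Real.log c - 2 * Real.log Q := by
    push_cast
    rw [hac, hbc, Real.log_div (by positivity) (by positivity), Real.log_mul (by positivity) (by positivity),
      Real.log_div haR hcR, Real.log_div hbR hcR, Real.log_pow]
    push_cast
    ring
  unfold cornerE
  rw [hlog]
  ring

/-! ### `τ(uv) = Σ_{d ∣ (u,v)} μ(d) τ(u/d) τ(v/d)` -/

/-- Reindexing `Σ_{d∣g} Σ_{c∣g/d} F(d, dc) = Σ_{m∣g} Σ_{d∣m} F(d, m)` (`g ≠ 0`). [folklore] -/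
theorem sum_div_sum_div_mul_eq {β : Type*} [AddCommMonoid β] {g : ℕ} (hg : g ≠ 0)
    (F : ℕ → ℕ → β) :
    ∑ d ∈ g.divisors, ∑ c ∈ (g / d).divisors, F d (d * c) =
      ∑ m ∈ g.divisors, ∑ d ∈ m.divisors, F d m := by
  -- right side: exchange to `Σ_{d ∣ g} Σ_{m ∣ g, d ∣ m}`
  have h1 : ∑ m ∈ g.divisors, ∑ d ∈ m.divisors, F d m =
      ∑ d ∈ g.divisors, ∑ m ∈ g.divisors.filter (fun m => d ∣ m), F d m := by
    refine Finset.sum_comm' ?_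
    intro m d
    simp only [Nat.mem_divisors, mem_filter]
    constructor
    · rintro ⟨⟨hmg, hg0⟩, hdm, hm0⟩
      exact ⟨⟨⟨hmg, hg0⟩, hdm⟩, hdm.trans hmg, hg0⟩
    · rintro ⟨⟨⟨hmg, hg0⟩, hdm⟩, hdg, -⟩
      refine ⟨⟨hmg, hg0⟩, hdm, ?_⟩
      rintro rfl; exact hg0 (zero_dvd_iff.mp hmg)
  rw [h1]
  refine sum_congr rfl fun d hd => ?_
  obtain ⟨hdg, -⟩ := Nat.mem_divisors.mp hd
  have hd0 : d ≠ 0 := by rintro rfl; exact hg (zero_dvd_iff.mp hdg)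
  refine Finset.sum_nbij' (fun c => d * c) (fun m => m / d) ?_ ?_ ?_ ?_ ?_
  · intro c hc
    obtain ⟨hcg, hgd⟩ := Nat.mem_divisors.mp hc
    simp only [mem_filter, Nat.mem_divisors]
    refine ⟨⟨?_, hg⟩, dvd_mul_right d c⟩
    have := mul_dvd_mul_left d hcg
    rwa [Nat.mul_div_cancel' hdg] at this
  · intro m hm
    simp only [mem_filter, Nat.mem_divisors] at hm
    obtain ⟨⟨hmg, -⟩, hdm⟩ := hm
    refine Nat.mem_divisors.mpr ⟨?_, (Nat.div_ne_zero_iff_of_dvd hdg).mpr ⟨hg, hd0⟩⟩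
    obtain ⟨k, rfl⟩ := hdm
    obtain ⟨m, hm⟩ := hdg
    rw [hm, Nat.mul_div_cancel_left k (Nat.pos_of_ne_zero hd0),
      Nat.mul_div_cancel_left m (Nat.pos_of_ne_zero hd0)]
    exact Nat.dvd_of_mul_dvd_mul_left (Nat.pos_of_ne_zero hd0) (hm ▸ hmg)
  · intro c _
    exact Nat.mul_div_cancel_left c (Nat.pos_of_ne_zero hd0)
  · intro m hm
    simp only [mem_filter, Nat.mem_divisors] at hm
    exact Nat.mul_div_cancel' hm.2
  · intro c _; rfl

/-- **`τ(uv) = Σ_{d ∣ (u,v)} μ(d)τ(u/d)τ(v/d)`** (`u, v ≥ 1`): Möbius inversion, along the divisors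
of `gcd(u,v)`, of the Hecke relation `τ(u)τ(v) = Σ_{c ∣ (u,v)} τ((u/c)(v/c))`.
[cite: KowalskiMichelVanderKam2000, (10) p. 7 — derivation (Hecke relation for τ, inverted)] -/
theorem card_divisors_mul_eq_sum_moebius {u v : ℕ} (hu : u ≠ 0) (hv : v ≠ 0) :
    ((u * v).divisors.card : ℝ) =
      ∑ d ∈ (Nat.gcd u v).divisors, (μ d : ℝ) * ((u / d).divisors.card : ℝ) * ((v / d).divisors.card : ℝ) := by
  set g := Nat.gcd u v with hgdef
  have hg : g ≠ 0 := Nat.gcd_ne_zero_left hu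
  -- expand τ(u/d)τ(v/d) by the Hecke relation at level g/d
  have h1 : ∀ d ∈ g.divisors, (μ d : ℝ) * ((u / d).divisors.card : ℝ) * ((v / d).divisors.card : ℝ) =
      ∑ c ∈ (g / d).divisors, (μ d : ℝ) * (((u / (d * c)) * (v / (d * c))).divisors.card : ℝ) := by
    intro d hd
    obtain ⟨hdg, -⟩ := Nat.mem_divisors.mp hd
    have hdu : d ∣ u := hdg.trans (Nat.gcd_dvd_left u v)
    have hdv : d ∣ v := hdg.trans (Nat.gcd_dvd_right u v)
    have hd0 : d ≠ 0 := by rintro rfl; exact hg (zero_dvd_iff.mp hdg)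
    have hud : u / d ≠ 0 := (Nat.div_ne_zero_iff_of_dvd hdu).mpr ⟨hu, hd0⟩
    have hvd : v / d ≠ 0 := (Nat.div_ne_zero_iff_of_dvd hdv).mpr ⟨hv, hd0⟩
    have hgcd : Nat.gcd (u / d) (v / d) = g / d := by rw [hgdef, Nat.gcd_div hdu hdv]
    rw [mul_assoc, cast_card_divisors_mul_card_divisors (R := ℝ) hud hvd, hgcd, Finset.mul_sum]
    refine Finset.sum_congr rfl fun c _ ↦ ?_
    rw [Nat.div_div_eq_div_mul, Nat.div_div_eq_div_mul]
  rw [Finset.sum_congr rfl h1,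
    sum_div_sum_div_mul_eq hg (fun d m ↦ (μ d : ℝ) * (((u / m) * (v / m)).divisors.card : ℝ))]
  -- Σ_{m ∣ g} τ((u/m)(v/m)) Σ_{d ∣ m} μ(d) = τ(uv)
  have h2 : ∀ m ∈ g.divisors, ∑ d ∈ m.divisors, (μ d : ℝ) * (((u / m) * (v / m)).divisors.card : ℝ) =
      if m = 1 then ((u * v).divisors.card : ℝ) else 0 := by
    intro m _
    rw [← Finset.sum_mul, Literature.NumberTheory.Sieve.sum_divisors_moebius_real m]
    split_ifs with h
    · subst h; simp
    · simp
  rw [Finset.sum_congr rfl h2, Finset.sum_ite_eq' g.divisors 1 (fun _ ↦ ((u * v).divisors.card : ℝ)),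
    if_pos (Nat.one_mem_divisors.2 hg)]

/-! ### Reindexing `(a, b, c ∣ (a,b)) ↔ (c, u, v)` -/

/-- **`Σ_{a,b ≤ N} Σ_{c ∣ (a,b)} F(a,b,c) = Σ_{c ≤ N} Σ_{u,v ≤ N/c} F(cu, cv, c)`.** [folklore] -/
theorem sum_sum_sum_gcd_divisors_eq {β : Type*} [AddCommMonoid β] (N : ℕ) (F : ℕ → ℕ → ℕ → β) :
    ∑ a ∈ Icc 1 N, ∑ b ∈ Icc 1 N, ∑ c ∈ (Nat.gcd a b).divisors, F a b c =
      ∑ c ∈ Icc 1 N, ∑ u ∈ Icc 1 (N / c), ∑ v ∈ Icc 1 (N / c), F (c * u) (c * v) c := by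
  have h1 : ∑ a ∈ Icc 1 N, ∑ b ∈ Icc 1 N, ∑ c ∈ (Nat.gcd a b).divisors, F a b c =
      ∑ a ∈ Icc 1 N, ∑ b ∈ Icc 1 N, ∑ c ∈ Icc 1 N, (if c ∣ a ∧ c ∣ b then F a b c else 0) := by
    refine Finset.sum_congr rfl fun a ha ↦ Finset.sum_congr rfl fun b hb ↦ ?_
    exact sum_divisors_gcd_eq_sum_Icc_ite (fun c ↦ F a b c) ha hb
  rw [h1]
  have h2 : ∑ a ∈ Icc 1 N, ∑ b ∈ Icc 1 N, ∑ c ∈ Icc 1 N, (if c ∣ a ∧ c ∣ b then F a b c else 0) =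
      ∑ c ∈ Icc 1 N, ∑ a ∈ Icc 1 N, ∑ b ∈ Icc 1 N, (if c ∣ a ∧ c ∣ b then F a b c else 0) := by
    have hin : ∀ a ∈ Icc 1 N, ∑ b ∈ Icc 1 N, ∑ c ∈ Icc 1 N, (if c ∣ a ∧ c ∣ b then F a b c else 0) =
        ∑ c ∈ Icc 1 N, ∑ b ∈ Icc 1 N, (if c ∣ a ∧ c ∣ b then F a b c else 0) :=
      fun a _ ↦ Finset.sum_comm
    rw [Finset.sum_congr rfl hin, Finset.sum_comm]
  rw [h2]
  refine Finset.sum_congr rfl fun c hc ↦ ?_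
  have hc0 : c ≠ 0 := by have := (Finset.mem_Icc.1 hc).1; omega
  have h3 : ∀ a ∈ Icc 1 N, ∑ b ∈ Icc 1 N, (if c ∣ a ∧ c ∣ b then F a b c else 0) =
      if c ∣ a then ∑ v ∈ Icc 1 (N / c), F a (c * v) c else 0 := by
    intro a _
    by_cases hca : c ∣ a
    · rw [if_pos hca, ← sum_Icc_ite_dvd_eq hc0 N (fun b ↦ F a b c)]
      refine Finset.sum_congr rfl fun b _ ↦ ?_
      by_cases hcb : c ∣ b
      · rw [if_pos ⟨hca, hcb⟩, if_pos hcb]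
      · rw [if_neg (fun h ↦ hcb h.2), if_neg hcb]
    · rw [if_neg hca]
      exact Finset.sum_eq_zero fun b _ ↦ if_neg (fun h ↦ hca h.1)
  rw [Finset.sum_congr rfl h3, sum_Icc_ite_dvd_eq hc0 N (fun a ↦ ∑ v ∈ Icc 1 (N / c), F a (c * v) c)]

/-! ### The decoupled form of the `h`-kernel quadratic form -/

/-- **The `τ`-decoupling of the diagonal quadratic form.** For every coefficient vector `x`, weight
`h`, `Q` and `N`:
`Σ_{a,b≤N} x_a x_b K_h(Q;a,b) = Σ_{c≤N} Σ_{d≤N/c} μ(d)·c·Σ_{k₁,k₂≤N/(cd)} y(k₁)y(k₂)·h(d²k₁k₂/Q²)`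
with `y(k) = τ(k)·x_{cdk}/(cdk)` (substitute `a = cu`, `b = cv` for `c ∣ (a,b)`, then
`τ(uv) = Σ_{d∣(u,v)} μ(d)τ(u/d)τ(v/d)` and `u = dk₁`, `v = dk₂`).
[cite: KowalskiMichelVanderKam2000, (21)–(23) and Prop. 5.1 — derivation (Selberg-type coordinates for a general cut-off)] -/
theorem quadForm_hKernel_eq (x : ℕ → ℝ) (h : ℝ → ℝ) (Q : ℝ) (N : ℕ) :
    ∑ a ∈ Icc 1 N, ∑ b ∈ Icc 1 N, x a * x b * hKernel h Q a b =
      ∑ c ∈ Icc 1 N, ∑ d ∈ Icc 1 (N / c), (μ d : ℝ) * c *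
        ∑ k₁ ∈ Icc 1 (N / (c * d)), ∑ k₂ ∈ Icc 1 (N / (c * d)),
          ((k₁.divisors.card : ℝ) * (x (c * d * k₁) / ((c * d * k₁ : ℕ) : ℝ))) *
            ((k₂.divisors.card : ℝ) * (x (c * d * k₂) / ((c * d * k₂ : ℕ) : ℝ))) *
              h ((d : ℝ) ^ 2 * k₁ * k₂ / Q ^ 2) := by
  -- Step 1: pull the divisor sum out and substitute a = cu, b = cv
  have step1 : ∑ a ∈ Icc 1 N, ∑ b ∈ Icc 1 N, x a * x b * hKernel h Q a b =
      ∑ a ∈ Icc 1 N, ∑ b ∈ Icc 1 N, ∑ c ∈ (Nat.gcd a b).divisors,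
        x a * x b * ((c : ℝ) * ((a / c * (b / c)).divisors.card : ℝ) *
          h (((a / c * (b / c) : ℕ) : ℝ) / Q ^ 2)) / ((a : ℝ) * b) := by
    refine Finset.sum_congr rfl fun a _ ↦ Finset.sum_congr rfl fun b _ ↦ ?_
    unfold hKernel
    rw [Finset.sum_div, Finset.mul_sum]
    exact Finset.sum_congr rfl fun c _ ↦ by ring
  rw [step1, sum_sum_sum_gcd_divisors_eq]
  refine Finset.sum_congr rfl fun c hc ↦ ?_
  have hc0 : c ≠ 0 := by have := (Finset.mem_Icc.1 hc).1; omega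
  have hcR : (c : ℝ) ≠ 0 := by exact_mod_cast hc0
  -- simplify the substituted terms: (cu)/c = u, (cv)/c = v
  have step2 : ∀ u ∈ Icc 1 (N / c), ∀ v ∈ Icc 1 (N / c),
      x (c * u) * x (c * v) * ((c : ℝ) * ((c * u / c * (c * v / c)).divisors.card : ℝ) *
        h (((c * u / c * (c * v / c) : ℕ) : ℝ) / Q ^ 2)) / (((c * u : ℕ) : ℝ) * ((c * v : ℕ) : ℝ)) =
      (c : ℝ)⁻¹ * ((x (c * u) / u) * (x (c * v) / v)) * ((u * v).divisors.card : ℝ) *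
        h ((u : ℝ) * v / Q ^ 2) := by
    intro u hu v hv
    have hu0 : (u : ℝ) ≠ 0 := by have := (Finset.mem_Icc.1 hu).1; positivity
    have hv0 : (v : ℝ) ≠ 0 := by have := (Finset.mem_Icc.1 hv).1; positivity
    rw [Nat.mul_div_cancel_left u (Nat.pos_of_ne_zero hc0),
      Nat.mul_div_cancel_left v (Nat.pos_of_ne_zero hc0)]
    push_cast
    field_simp
  rw [Finset.sum_congr rfl fun u hu ↦ Finset.sum_congr rfl fun v hv ↦ step2 u hu v hv]
  -- Step 3: τ(uv) = Σ_{d ∣ (u,v)} μ(d)τ(u/d)τ(v/d), and substitute u = dk₁, v = dk₂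
  have step3 : ∀ u ∈ Icc 1 (N / c), ∀ v ∈ Icc 1 (N / c),
      (c : ℝ)⁻¹ * ((x (c * u) / u) * (x (c * v) / v)) * ((u * v).divisors.card : ℝ) *
        h ((u : ℝ) * v / Q ^ 2) =
      ∑ d ∈ (Nat.gcd u v).divisors, (c : ℝ)⁻¹ * ((x (c * u) / u) * (x (c * v) / v)) *
        ((μ d : ℝ) * ((u / d).divisors.card : ℝ) * ((v / d).divisors.card : ℝ)) *
          h ((u : ℝ) * v / Q ^ 2) := by
    intro u hu v hv
    have hu0 : u ≠ 0 := by have := (Finset.mem_Icc.1 hu).1; omega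
    have hv0 : v ≠ 0 := by have := (Finset.mem_Icc.1 hv).1; omega
    rw [card_divisors_mul_eq_sum_moebius hu0 hv0, Finset.mul_sum, Finset.sum_mul]
  rw [Finset.sum_congr rfl fun u hu ↦ Finset.sum_congr rfl fun v hv ↦ step3 u hu v hv,
    sum_sum_sum_gcd_divisors_eq (N / c)]
  refine Finset.sum_congr rfl fun d hd ↦ ?_
  have hd0 : d ≠ 0 := by have := (Finset.mem_Icc.1 hd).1; omega
  have hdR : (d : ℝ) ≠ 0 := by exact_mod_cast hd0
  rw [Nat.div_div_eq_div_mul, Finset.mul_sum]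
  refine Finset.sum_congr rfl fun k₁ hk₁ ↦ ?_
  rw [Finset.mul_sum]
  refine Finset.sum_congr rfl fun k₂ hk₂ ↦ ?_
  have hk₁0 : (k₁ : ℝ) ≠ 0 := by have := (Finset.mem_Icc.1 hk₁).1; positivity
  have hk₂0 : (k₂ : ℝ) ≠ 0 := by have := (Finset.mem_Icc.1 hk₂).1; positivity
  rw [Nat.mul_div_cancel_left k₁ (Nat.pos_of_ne_zero hd0),
    Nat.mul_div_cancel_left k₂ (Nat.pos_of_ne_zero hd0),
    show c * d * k₁ = c * (d * k₁) by ring, show c * d * k₂ = c * (d * k₂) by ring]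
  push_cast
  field_simp

end Summit.Parity.GeneralizedHardyLittlewood.Theorems.BeyondDiagonalBeatsQuarter.Corner
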